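import Summits.QuantumFields.BalabanUV.Beta.MultiscaleGrowthCells

/-!
# `Summit.QuantumFields.BalabanUV.Beta.MultiscaleNestedGrading` — THE ADDITIVE GRADING IS A THEOREM OF THE (2.1)–(2.2) SHAPE:
# sup-metric separation of non-adjacent level sets ⟹ `|e(x) − e(y)| ≤ 1 + d_n(x,y)∕R′` (MODEL; O.2 item (ii) geometry), by a LEVEL POTENTIAL

HONEST FRAMING (page 1 of everything in this cell).  Discharging `FlowStep.BetaPertH` would make Bałaban's ultraviolet
stability UNCONDITIONAL — a constructive-QFT result; it is NOT the continuum limit and NOT the Clay problem.  This module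
discharges nothing of `BetaPertH`; [folklore] metric bookkeeping, kernel-checked (unit `b2b-balaban-beta-d4-p3`, road P3 «reduction
road», gen 11; claim «GRADING-FROM-NESTING», journal 2026-08-20T20:23Z; companion of `MultiscaleGrowth` ∕ `MultiscaleGrowthCells`).
HONEST DEPENDENCY: continuum YM on T⁴ ⇐ BetaPertH ∧ nine spine estimates (0/9 proved); BetaPertH ⇐ (D1) ∧ (D4) ∧ CAP+tail;
G-an2-4 gates asym, D1 and NE2/3/4.

WHY THIS FILE.  After `MultiscaleGrowth(Cells)` the DATA of the (2.16)-currency MODEL ENDs is {cube partition, ADDITIVE GRADING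
`|e(x) − e(y)| ≤ A + d_n(x,y)∕R` (beta-d4-p2 `MultiscaleDistanceGraded` §4), a free `ε`, the rate condition}.  The grading is itself a
two-point statement in the scale-adapted distance; print's geometry ([B6] (2.1) `Ω₁ ⊃ Ω₂ ⊃ … ⊃ Ω_k`, (2.2) «(L^jη)⁻¹ dist(Ω^c_j, Ω_{j+1}) >
RM») is a statement about SETS in the plain lattice distance.  THIS FILE DERIVES THE FORMER FROM THE SHAPE OF THE LATTER, with `A = 1`
and NO loss in `R`: on the torus `UT N` with a level function `e` (scales `n = L^e`, `L ≥ 1`) assume only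
  (SEP) `e(x) ≤ j − 1 ∧ e(y) ≥ j + 1 ⟹ dist(x, y) ≥ R′·L^j + 1` (`dist` = the sup torus distance of `B5TorusCover.UT`; with
        `Ω_j := {e ≥ j}` this is (2.2)'s display, `R′ = RM`);
then **`abs_level_sub_le`**: `|e(x) − e(y)| ≤ 1 + d_n(x, y)∕R′` for all `x, y`.
ROUTE (no walk surgery).  §1 the capped sup-distance `capDist e ℓ T x = min(T, dist(x, {e ≤ ℓ − 1}))` (`= T` on the empty set) is
`dist`-1-Lipschitz, vanishes on `{e ≤ ℓ − 1}` and equals the cap `T` wherever (SEP) puts `{e ≤ ℓ − 1}` at distance `≥ T`; §2 the LEVEL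
POTENTIAL `levelPot(x) = Σ_{ℓ=1}^{E} capDist e ℓ (R′L^ℓ) x ∕ (R′L^ℓ)` (`E = max e`) satisfies `e(x) − 1 ≤ levelPot(x) ≤ e(x)` (the terms
`ℓ ≤ e(x) − 1` sit at the cap, the terms `ℓ ≥ e(x) + 1` vanish); §3 across a bond `u ~ u′` (`dist ≤ 1`, `B5Leibniz121.dist_up_le`) only the
term `ℓ = max(e u, e u′)` moves — the lower terms are pinned at the cap on BOTH endpoints by the `+1` of (SEP), the higher ones vanish on
both — by at most `1∕(R′L^ℓ) ≤ slen(u, u′)∕R′`; so `levelPot` is bondwise `(slen∕R′)`-Lipschitz and beta-d4-p2's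
`MultiscaleDistanceGraded.abs_sub_le_sdist_div` + `reachable_torus` give `|levelPot(x) − levelPot(y)| ≤ d_n(x,y)∕R′`, whence the datum;
§4 the two ENDs of `MultiscaleGrowthCells` §3 over (SEP) BY NAME: **`wrs_cellSandwich_levelOp_of_nesting`**, **`wrs_inv_levelOp_le_of_nesting`**
— DATA of the (2.16)-currency MODEL ENDs = {cube partition with levels `e` (`siteScale = L^e`), the separation constant `R′`, a free
`ε > 0`, the rate condition `κ − κ′ > ε + 2d·log L∕R′` (cells) ∕ `ε + (d+1)·log L∕R′` (sites)}.
NOT HERE: Bałaban's regions `Ω_j = B^j(Λ_j)` themselves (DATA: which cubes carry which level), Dirichlet holes, vector operators, sup-norm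
(3.42).  ABSOLUTE RULE: nothing printed is cited as a fact; (2.1)–(2.2) are LOCATORS of the hypothesis SHAPE.  Row D4: class of (T3) ∕ NODE
O.2 ∕ row D4 UNCHANGED (critical-path width 0); D4 DISCHARGE NO DATE; NOT BetaPertH, NOT continuum, NOT Clay, NOT summit progress.
-/

open scoped BigOperators Matrix ComplexConjugate
open Finset Function

namespace Summit.QuantumFields.BalabanUV.Beta.MultiscaleNestedGrading
open Summit.QuantumFields.BalabanUV.Beta.MultiscaleDistance
open Summit.QuantumFields.BalabanUV.Beta.MultiscaleDistanceGraded (reachable_torus abs_sub_le_sdist_div)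
open Summit.QuantumFields.BalabanUV.Beta.MultiscaleDistanceMetric (sdist_comm)
open Literature.MathematicalPhysics.QuantumFieldTheory.Balaban1983to89
open Literature.MathematicalPhysics.QuantumFieldTheory.Balaban1983to89.B9Thm37GluePU (bsrc btgt bsrc_apply btgt_apply)
open Literature.MathematicalPhysics.QuantumFieldTheory.Balaban1983to89.B5Leibniz121 (up dist_up_le)
open B5TorusCover (UT Ctr ctrU)

noncomputable section

variable {d : ℕ} {N : Fin d → ℕ} [∀ i, NeZero (N i)]

/-! ## §1 The capped sup-distance to a sub-level set -/

/-- **The capped sup-distance from `x` to the sub-level set `{y : e y ≤ ℓ − 1}`**: `min(T, dist(x, y))` minimised over that set, and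
`T` when the set is empty (realised as a `Finset.inf'` over all sites, the sites outside the set contributing the cap). [folklore] -/
def capDist (e : UT N → ℕ) (ℓ : ℕ) (T : ℝ) (x : UT N) : ℝ :=
  univ.inf' ⟨x, mem_univ x⟩ fun y => if e y + 1 ≤ ℓ then min T (dist x y) else T

/-- `capDist ≤ T`. [folklore] -/
theorem capDist_le (e : UT N → ℕ) (ℓ : ℕ) (T : ℝ) (x : UT N) : capDist e ℓ T x ≤ T := by
  refine (Finset.inf'_le _ (mem_univ x)).trans ?_
  by_cases h : e x + 1 ≤ ℓ
  · rw [if_pos h]; exact min_le_left _ _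
  · rw [if_neg h]

/-- `0 ≤ capDist` for `T ≥ 0`. [folklore] -/
theorem capDist_nonneg (e : UT N → ℕ) (ℓ : ℕ) {T : ℝ} (hT : 0 ≤ T) (x : UT N) : 0 ≤ capDist e ℓ T x := by
  refine Finset.le_inf' _ _ fun y _ => ?_
  by_cases h : e y + 1 ≤ ℓ
  · rw [if_pos h]; exact le_min hT dist_nonneg
  · rw [if_neg h]; exact hT

/-- On the sub-level set the capped distance VANISHES. [folklore] -/
theorem capDist_eq_zero (e : UT N → ℕ) {ℓ : ℕ} {T : ℝ} (hT : 0 ≤ T) {x : UT N} (hx : e x + 1 ≤ ℓ) : capDist e ℓ T x = 0 := by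
  refine le_antisymm ?_ (capDist_nonneg e ℓ hT x)
  refine (Finset.inf'_le _ (mem_univ x)).trans ?_
  rw [if_pos hx, dist_self, min_eq_right hT]

/-- Where every point of the sub-level set is at distance `≥ T`, the capped distance IS THE CAP. [folklore] -/
theorem capDist_eq_cap (e : UT N → ℕ) {ℓ : ℕ} {T : ℝ} {x : UT N} (hfar : ∀ y, e y + 1 ≤ ℓ → T ≤ dist x y) :
    capDist e ℓ T x = T := by
  refine le_antisymm (capDist_le e ℓ T x) (Finset.le_inf' _ _ fun y _ => ?_)
  by_cases h : e y + 1 ≤ ℓ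
  · rw [if_pos h, min_eq_left (hfar y h)]
  · rw [if_neg h]

/-- **The capped distance is `1`-Lipschitz for the sup torus distance** (one direction; the minimiser for `x′` tests `x`). [folklore] -/
theorem capDist_le_capDist_add (e : UT N → ℕ) (ℓ : ℕ) (T : ℝ) (x x' : UT N) :
    capDist e ℓ T x ≤ capDist e ℓ T x' + dist x x' := by
  obtain ⟨y₀, _, hy₀⟩ := Finset.exists_mem_eq_inf' (s := (univ : Finset (UT N))) ⟨x', mem_univ x'⟩
    (fun y => if e y + 1 ≤ ℓ then min T (dist x' y) else T)
  have hD : 0 ≤ dist x x' := dist_nonneg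
  unfold capDist
  rw [hy₀]
  refine (Finset.inf'_le _ (mem_univ y₀)).trans ?_
  by_cases h : e y₀ + 1 ≤ ℓ
  · rw [if_pos h, if_pos h]
    have htri : dist x y₀ ≤ dist x' y₀ + dist x x' := by
      rw [add_comm]; exact dist_triangle x x' y₀
    rcases le_total T (dist x' y₀) with h1 | h1
    · rw [min_eq_left h1]
      exact (min_le_left _ _).trans (le_add_of_nonneg_right hD)
    · rw [min_eq_right h1]
      exact (min_le_right _ _).trans htri
  · rw [if_neg h, if_neg h]
    exact le_add_of_nonneg_right hD

/-- Hence `|capDist x − capDist x′| ≤ dist(x, x′)`. [folklore] -/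
theorem abs_capDist_sub_le (e : UT N → ℕ) (ℓ : ℕ) (T : ℝ) (x x' : UT N) :
    |capDist e ℓ T x - capDist e ℓ T x'| ≤ dist x x' := by
  rw [abs_sub_le_iff]
  constructor
  · linarith [capDist_le_capDist_add e ℓ T x x']
  · have := capDist_le_capDist_add e ℓ T x' x
    rw [dist_comm] at this
    linarith

/-! ## §2 The level potential and its bracket `e − 1 ≤ levelPot ≤ e` -/

/-- **THE LEVEL POTENTIAL**: `Σ_{j < E} capDist e (j+1) (R′L^{j+1}) x ∕ (R′L^{j+1})`, `E = max e` — one unit per level fully below `x`,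
a fraction for the level of `x` itself. [folklore] -/
def levelPot (e : UT N → ℕ) (R' : ℝ) (L : ℕ) (x : UT N) : ℝ :=
  ∑ j ∈ range (univ.sup e), capDist e (j + 1) (R' * (L : ℝ) ^ (j + 1)) x / (R' * (L : ℝ) ^ (j + 1))

/-- Each term of the potential lies in `[0, 1]`. [folklore] -/
theorem term_mem (e : UT N → ℕ) {R' : ℝ} (hR : 0 < R') {L : ℕ} (hL : 1 ≤ L) (ℓ : ℕ) (x : UT N) :
    0 ≤ capDist e ℓ (R' * (L : ℝ) ^ ℓ) x / (R' * (L : ℝ) ^ ℓ) ∧ capDist e ℓ (R' * (L : ℝ) ^ ℓ) x / (R' * (L : ℝ) ^ ℓ) ≤ 1 := by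
  have hL0 : (0 : ℝ) < L := by exact_mod_cast hL
  have hT : 0 < R' * (L : ℝ) ^ ℓ := mul_pos hR (pow_pos hL0 ℓ)
  exact ⟨div_nonneg (capDist_nonneg e ℓ hT.le x) hT.le, (div_le_one hT).mpr (capDist_le e ℓ _ x)⟩

/-- **Lower bracket**: under (SEP), `e(x) − 1 ≤ levelPot(x)` — every level `ℓ ≤ e(x) − 1` contributes a full unit. [folklore] -/
theorem sub_one_le_levelPot (e : UT N → ℕ) {R' : ℝ} (hR : 0 < R') {L : ℕ} (hL : 1 ≤ L)
    (hsep : ∀ (j : ℕ) (x y : UT N), e x + 1 ≤ j → j + 1 ≤ e y → R' * (L : ℝ) ^ j + 1 ≤ dist x y) (x : UT N) :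
    (e x : ℝ) - 1 ≤ levelPot e R' L x := by
  have hL0 : (0 : ℝ) < L := by exact_mod_cast hL
  have hxE : e x ≤ univ.sup e := Finset.le_sup (mem_univ x)
  -- termwise: term_j ≥ [j + 2 ≤ e x]
  have hterm : ∀ j ∈ range (univ.sup e), (if j + 2 ≤ e x then (1 : ℝ) else 0) ≤
      capDist e (j + 1) (R' * (L : ℝ) ^ (j + 1)) x / (R' * (L : ℝ) ^ (j + 1)) := by
    intro j _
    have hT : 0 < R' * (L : ℝ) ^ (j + 1) := mul_pos hR (pow_pos hL0 _)
    by_cases hj : j + 2 ≤ e x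
    · rw [if_pos hj, capDist_eq_cap e (fun y hy => ?_), div_self hT.ne']
      have h := hsep (j + 1) y x hy (by omega)
      rw [dist_comm] at h
      linarith
    · rw [if_neg hj]
      exact (term_mem e hR hL (j + 1) x).1
  have hcount : (e x : ℝ) - 1 ≤ ∑ j ∈ range (univ.sup e), (if j + 2 ≤ e x then (1 : ℝ) else 0) := by
    rw [Finset.sum_boole]
    have hsub : range (e x - 1) ⊆ (range (univ.sup e)).filter (fun j => j + 2 ≤ e x) := by
      intro j hj
      rw [mem_range] at hj
      rw [mem_filter, mem_range]
      omega
    have hcard := Finset.card_le_card hsub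
    rw [card_range] at hcard
    have h1 : (e x : ℝ) - 1 ≤ ((e x - 1 : ℕ) : ℝ) := by
      rcases Nat.eq_zero_or_pos (e x) with h0 | h0
      · rw [h0]; norm_num
      · rw [Nat.cast_sub h0, Nat.cast_one]
    exact h1.trans (by exact_mod_cast hcard)
  exact hcount.trans (Finset.sum_le_sum hterm)

/-- **Upper bracket**: `levelPot(x) ≤ e(x)` — the levels `ℓ ≥ e(x) + 1` contribute nothing. [folklore] -/
theorem levelPot_le (e : UT N → ℕ) {R' : ℝ} (hR : 0 < R') {L : ℕ} (hL : 1 ≤ L) (x : UT N) :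
    levelPot e R' L x ≤ e x := by
  have hL0 : (0 : ℝ) < L := by exact_mod_cast hL
  have hterm : ∀ j ∈ range (univ.sup e), capDist e (j + 1) (R' * (L : ℝ) ^ (j + 1)) x / (R' * (L : ℝ) ^ (j + 1)) ≤
      (if j + 1 ≤ e x then (1 : ℝ) else 0) := by
    intro j _
    have hT : 0 < R' * (L : ℝ) ^ (j + 1) := mul_pos hR (pow_pos hL0 _)
    by_cases hj : j + 1 ≤ e x
    · rw [if_pos hj]
      exact (term_mem e hR hL (j + 1) x).2
    · rw [if_neg hj, capDist_eq_zero e hT.le (by omega), zero_div]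
  refine (Finset.sum_le_sum hterm).trans ?_
  rw [Finset.sum_boole]
  have hsub : (range (univ.sup e)).filter (fun j => j + 1 ≤ e x) ⊆ range (e x) := by
    intro j hj
    rw [mem_filter, mem_range] at hj
    rw [mem_range]
    omega
  have hcard := Finset.card_le_card hsub
  rw [card_range] at hcard
  exact_mod_cast hcard

/-! ## §3 Across a bond only the top-level term moves: the potential is bondwise `(slen∕R′)`-Lipschitz -/

/-- **One bond**: for `u, u′` at sup distance `≤ 1`, under (SEP), `|levelPot(u′) − levelPot(u)| ≤ 1∕(R′L^a)` with `a = max(e u, e u′)` —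
the terms of level `ℓ ≤ a − 1` equal the cap at both endpoints (the endpoint of level `a ≥ ℓ + 1` is `≥ R′L^ℓ + 1` away from `{e ≤ ℓ − 1}`,
its neighbour `≥ R′L^ℓ`), the terms `ℓ ≥ a + 1` vanish at both, the term `ℓ = a` is `dist`-1-Lipschitz. [folklore] -/
theorem abs_levelPot_sub_le (e : UT N → ℕ) {R' : ℝ} (hR : 0 < R') {L : ℕ} (hL : 1 ≤ L)
    (hsep : ∀ (j : ℕ) (x y : UT N), e x + 1 ≤ j → j + 1 ≤ e y → R' * (L : ℝ) ^ j + 1 ≤ dist x y)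
    {u u' : UT N} (hd : dist u u' ≤ 1) :
    |levelPot e R' L u' - levelPot e R' L u| ≤ (R' * (L : ℝ) ^ max (e u) (e u'))⁻¹ := by
  have hL0 : (0 : ℝ) < L := by exact_mod_cast hL
  set a := max (e u) (e u') with ha
  have hTpos : ∀ m : ℕ, 0 < R' * (L : ℝ) ^ m := fun m => mul_pos hR (pow_pos hL0 m)
  -- the pinned terms: level ℓ = j + 1 ≤ a − 1, both endpoints at the cap
  have hcap : ∀ j, j + 2 ≤ a → ∀ w ∈ ({u, u'} : Finset (UT N)),
      capDist e (j + 1) (R' * (L : ℝ) ^ (j + 1)) w = R' * (L : ℝ) ^ (j + 1) := by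
    intro j hj w hw
    -- the endpoint of top level
    have htop : ∃ t ∈ ({u, u'} : Finset (UT N)), e t = a ∧ dist w t ≤ 1 := by
      rcases le_total (e u) (e u') with h | h
      · refine ⟨u', by simp, by rw [ha, max_eq_right h], ?_⟩
        rw [Finset.mem_insert, Finset.mem_singleton] at hw
        rcases hw with rfl | rfl
        · exact hd
        · rw [dist_self]; exact zero_le_one
      · refine ⟨u, by simp, by rw [ha, max_eq_left h], ?_⟩
        rw [Finset.mem_insert, Finset.mem_singleton] at hw
        rcases hw with rfl | rfl
        · rw [dist_self]; exact zero_le_one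
        · rw [dist_comm]; exact hd
    obtain ⟨t, _, het, hwt⟩ := htop
    refine capDist_eq_cap e fun y hy => ?_
    have h := hsep (j + 1) y t hy (by omega)
    have htri : dist y t ≤ dist y w + dist w t := dist_triangle y w t
    rw [dist_comm y w] at htri
    linarith
  -- the vanishing terms: level ℓ = j + 1 ≥ a + 1, both endpoints in the sub-level set
  have hzero : ∀ j, a ≤ j → ∀ w ∈ ({u, u'} : Finset (UT N)), capDist e (j + 1) (R' * (L : ℝ) ^ (j + 1)) w = 0 := by
    intro j hj w hw
    refine capDist_eq_zero e (hTpos _).le ?_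
    rw [Finset.mem_insert, Finset.mem_singleton] at hw
    rcases hw with rfl | rfl
    · have : e w ≤ a := le_max_left _ _
      omega
    · have : e w ≤ a := le_max_right _ _
      omega
  -- termwise bound by an indicator of the top level
  have hterm : ∀ j ∈ range (univ.sup e),
      |capDist e (j + 1) (R' * (L : ℝ) ^ (j + 1)) u' / (R' * (L : ℝ) ^ (j + 1)) -
        capDist e (j + 1) (R' * (L : ℝ) ^ (j + 1)) u / (R' * (L : ℝ) ^ (j + 1))| ≤
      if j + 1 = a then (R' * (L : ℝ) ^ a)⁻¹ else 0 := by
    intro j _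
    by_cases hj : j + 1 = a
    · rw [if_pos hj, ← sub_div, abs_div, abs_of_pos (hTpos _), div_le_iff₀ (hTpos _), ← hj,
        inv_mul_cancel₀ (hTpos _).ne']
      rw [dist_comm] at hd
      exact (abs_capDist_sub_le e (j + 1) _ u' u).trans hd
    · rw [if_neg hj]
      rcases Nat.lt_or_ge (j + 1) a with hlt | hge
      · rw [hcap j (by omega) u' (by simp), hcap j (by omega) u (by simp), sub_self, abs_zero]
      · rw [hzero j (by omega) u' (by simp), hzero j (by omega) u (by simp), zero_div, sub_self, abs_zero]
  calc |levelPot e R' L u' - levelPot e R' L u|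
      = |∑ j ∈ range (univ.sup e), (capDist e (j + 1) (R' * (L : ℝ) ^ (j + 1)) u' / (R' * (L : ℝ) ^ (j + 1)) -
          capDist e (j + 1) (R' * (L : ℝ) ^ (j + 1)) u / (R' * (L : ℝ) ^ (j + 1)))| := by
        rw [levelPot, levelPot, ← Finset.sum_sub_distrib]
    _ ≤ ∑ j ∈ range (univ.sup e), |capDist e (j + 1) (R' * (L : ℝ) ^ (j + 1)) u' / (R' * (L : ℝ) ^ (j + 1)) -
          capDist e (j + 1) (R' * (L : ℝ) ^ (j + 1)) u / (R' * (L : ℝ) ^ (j + 1))| := Finset.abs_sum_le_sum_abs _ _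
    _ ≤ ∑ j ∈ range (univ.sup e), (if j + 1 = a then (R' * (L : ℝ) ^ a)⁻¹ else 0) := Finset.sum_le_sum hterm
    _ ≤ (R' * (L : ℝ) ^ a)⁻¹ := by
        rcases Nat.eq_zero_or_pos a with h0 | h0
        · rw [Finset.sum_eq_zero (fun j _ => by rw [if_neg (by omega)])]
          exact (inv_pos.mpr (hTpos a)).le
        · have hrw : ∀ j ∈ range (univ.sup e), (if j + 1 = a then (R' * (L : ℝ) ^ a)⁻¹ else (0 : ℝ)) =
              (if a - 1 = j then (R' * (L : ℝ) ^ a)⁻¹ else 0) := fun j _ => by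
            by_cases h : j + 1 = a
            · rw [if_pos h, if_pos (by omega)]
            · rw [if_neg h, if_neg (by omega)]
          rw [Finset.sum_congr rfl hrw, Finset.sum_ite_eq]
          split_ifs
          · exact le_rfl
          · exact (inv_pos.mpr (hTpos a)).le

/-- **The potential is bondwise `(slen∕R′)`-Lipschitz** for the scales `n = L^e`: on a bond `(u, μ)` of the torus,
`|levelPot(u + e_μ) − levelPot(u)| ≤ slen(u, u + e_μ)∕R′` (`slen = min(L^{−e u}, L^{−e u′}) = L^{−max}`). [folklore] -/
theorem levelPot_bond_le (e : UT N → ℕ) (n : UT N → ℕ) {L : ℕ} (hL : 1 ≤ L) (hn : ∀ x, n x = L ^ e x) {R' : ℝ} (hR : 0 < R')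
    (hsep : ∀ (j : ℕ) (x y : UT N), e x + 1 ≤ j → j + 1 ≤ e y → R' * (L : ℝ) ^ j + 1 ≤ dist x y) (b : UT N × Fin d) :
    |levelPot e R' L (btgt b) - levelPot e R' L (bsrc b)| ≤ slen n (bsrc b) (btgt b) / R' := by
  obtain ⟨u, μ⟩ := b
  simp only [bsrc_apply, btgt_apply]
  have hL0 : (0 : ℝ) < L := by exact_mod_cast hL
  have hL1 : (1 : ℝ) ≤ L := by exact_mod_cast hL
  have h := abs_levelPot_sub_le e hR hL hsep (u := u) (u' := up u μ) (dist_up_le u μ)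
  refine h.trans ?_
  -- (R′ L^a)⁻¹ ≤ min(L^{-e u}, L^{-e u'}) / R′
  rw [slen, hn u, hn (up u μ), mul_inv, mul_comm, ← div_eq_mul_inv]
  refine div_le_div_of_nonneg_right (le_min ?_ ?_) hR.le
  · push_cast
    exact inv_anti₀ (pow_pos hL0 _) (pow_le_pow_right₀ hL1 (le_max_left _ _))
  · push_cast
    exact inv_anti₀ (pow_pos hL0 _) (pow_le_pow_right₀ hL1 (le_max_right _ _))

/-- **THE ADDITIVE GRADING FROM THE (2.1)–(2.2) SHAPE.**  Torus `UT N`; level function `e` with scales `n = L^e` (`L ≥ 1`); separation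
(SEP) `e(x) ≤ j − 1 ∧ e(y) ≥ j + 1 ⟹ dist(x, y) ≥ R′·L^j + 1` (`R′ > 0`).  Then for ALL `x, y`:
`|e(x) − e(y)| ≤ 1 + d_n(x, y)∕R′` — beta-d4-p2's additive datum with `A = 1`, `R = R′`.
[cite: Balaban1984PropagatorsII, (2.1)-(2.2) p.224 + (2.46) p.231] [folklore] -/
theorem abs_level_sub_le (e : UT N → ℕ) (n : UT N → ℕ) {L : ℕ} (hL : 1 ≤ L) (hn : ∀ x, n x = L ^ e x) {R' : ℝ} (hR : 0 < R')
    (hsep : ∀ (j : ℕ) (x y : UT N), e x + 1 ≤ j → j + 1 ≤ e y → R' * (L : ℝ) ^ j + 1 ≤ dist x y) (x y : UT N) :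
    |(e x : ℝ) - e y| ≤ ((1 : ℕ) : ℝ) + sdist bsrc btgt n x y / R' := by
  have hg := abs_sub_le_sdist_div bsrc btgt n (levelPot e R' L) hR (levelPot_bond_le e n hL hn hR hsep) (reachable_torus x y)
  have hx1 := sub_one_le_levelPot e hR hL hsep x
  have hx2 := levelPot_le e hR hL x
  have hy1 := sub_one_le_levelPot e hR hL hsep y
  have hy2 := levelPot_le e hR hL y
  rw [Nat.cast_one, abs_sub_le_iff]
  rw [abs_sub_le_iff] at hg
  constructor <;> linarith [hg.1, hg.2]

/-! ## §4 The (2.16)-currency ENDs over the (2.1)–(2.2) SHAPE (BY NAME) -/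

section Ends
open Summit.QuantumFields.BalabanUV.Beta.BoxPoincare (Box)
open Summit.QuantumFields.BalabanUV.Beta.MultiscaleCoerciveTorus
open Summit.QuantumFields.BalabanUV.Beta.MultiscaleDecayBudget
open Summit.QuantumFields.BalabanUV.Beta.AccretiveCombesThomas
open Summit.QuantumFields.BalabanUV.Beta.AccretiveCombesThomasSandwich (sandwich)
open Summit.QuantumFields.BalabanUV.Beta.MultiscaleGrowthCells (wrs_cellSandwich_levelOp_of_grading wrs_inv_levelOp_le_of_grading)
open Summit.QuantumFields.BalabanUV.Beta.CovariantTowerMatrix (cmat)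
open Literature.MathematicalPhysics.QuantumFieldTheory.Balaban1983to89.B9Thm37GlueTorusCov (tblk)
open Literature.MathematicalPhysics.QuantumFieldTheory.Balaban1983to89.B9Thm37GlueTorusCovLevels (levelOp)
open Literature.MathematicalPhysics.QuantumFieldTheory.Balaban1983to89.B5Prop11Lower (nsq)
open Literature.MathematicalPhysics.QuantumFieldTheory.Balaban1983to89.B13PerturbativeStep (WRS)

variable [NeZero d] {Cp J K : Type} [Fintype Cp] [DecidableEq Cp] [Fintype J] [Fintype K]
  (S : J → ℕ) (hS : ∀ l, 1 ≤ S l) (hdivS : ∀ l i, S l ∣ N i) (lvl : K → J) (zc : (k : K) → Ctr N (S (lvl k)))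

/-- **WRS OF THE CELL-LATTICE SANDWICH OF THE MULTI-REGION MODEL OPERATOR OVER THE (2.1)–(2.2) SHAPE.**
`MultiscaleGrowthCells.wrs_cellSandwich_levelOp_of_grading` with its additive datum SUPPLIED by `abs_level_sub_le` (`A = 1`, `R = R′`):
DATA = the cube partition with levels `e` (`siteScale = L^e`), the separation (SEP) with constant `R′ > 0`, a free `ε > 0`, and the rate
condition `e^{ε + 2d·log L∕R′}·e^{−(κ−κ′)} < 1`. [cite: Balaban1988RG2Cluster, (2.16) p.16; Balaban1984PropagatorsII, (2.1)-(2.2) p.224] [folklore] -/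
theorem wrs_cellSandwich_levelOp_of_nesting [Nonempty Cp]
    (hdisj : ∀ k k' v v', cellPt S hS hdivS lvl zc k v = cellPt S hS hdivS lvl zc k' v' → k = k')
    (hcover : ∀ x : UT N, ∃ k, ∃ v : Box d (S (lvl k)), cellPt S hS hdivS lvl zc k v = x)
    (Rm : UT N × Fin d → Cp → Cp → ℝ) (hRm : ∀ b i j, ∑ k, Rm b k i * Rm b k j = if i = j then (1 : ℝ) else 0)
    (T : J → UT N → Cp → Cp → ℝ) (hT : ∀ l x i i', ∑ k, T l x k i * T l x k i' = if i = i' then (1 : ℝ) else 0)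
    (a : J → ℝ) (ha : ∀ j, 0 ≤ a j) (ω : J → UT N → ℝ)
    (hsupp : ∀ l x, ω l (ctrU N (S l) (tblk (hS l) (hdivS l) x)) ≠ 0 → ∃ k v, lvl k = l ∧ cellPt S hS hdivS lvl zc k v = x)
    {amax : ℝ} (hamax : 0 ≤ amax)
    (hscale : ∀ k, a (lvl k) * ω (lvl k) (ctrU N (S (lvl k)) (zc k)) ^ 2 * (S (lvl k) : ℝ) ^ d ≤ amax / (S (lvl k) : ℝ) ^ 2)
    (c : UT N × Fin d → ℝ) {cmax : ℝ} (hc : ∀ b, |c b| ≤ cmax) {C : ℝ}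
    (hcoer : ∀ f : UT N × Cp → ℝ,
      C * ∑ k, ((S (lvl k) : ℝ) ^ 2)⁻¹ * ∑ v : Box d (S (lvl k)), ∑ i, f (cellPt S hS hdivS lvl zc k v, i) ^ 2 ≤
        ∑ p, f p * levelOp bsrc btgt c Rm (fun l x => ctrU N (S l) (tblk (hS l) (hdivS l) x))
          (fun l x => ω l (ctrU N (S l) (tblk (hS l) (hdivS l) x))) T a f p)
    {κ : ℝ} (hκ0 : 0 ≤ κ) (hκ1 : κ ≤ 1) (hμ : 0 < C - 2 * d * cmax ^ 2 * κ ^ 2 - amax * (Real.exp (2 * d * κ) - 1))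
    {Smax : ℕ} (hSmax1 : 1 ≤ Smax) (hSmax : ∀ l, S l ≤ Smax)
    (q : K → UT N × Cp → ℂ) (hq : ∀ k p, cellOf S hS hdivS lvl zc hcover p.1 ≠ k → q k p = 0) {Nq : ℝ} (hNq0 : 0 ≤ Nq)
    (hNq : ∀ k, nsq (q k) ≤ Nq)
    {L : ℕ} (hL : 1 ≤ L) (e : UT N → ℕ) (hne : ∀ x, siteScale S hS hdivS lvl zc hcover x = L ^ e x) {R' : ℝ} (hR : 0 < R')
    (hsep : ∀ (j : ℕ) (x y : UT N), e x + 1 ≤ j → j + 1 ≤ e y → R' * (L : ℝ) ^ j + 1 ≤ dist x y)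
    {ε : ℝ} (hε : 0 < ε) {κ' : ℝ} (hκ' : κ' ≤ κ)
    (hrate : Real.exp (ε + 2 * (Real.log L / R') * d) * Real.exp (-(κ - κ')) < 1) :
    WRS κ' (fun k k' => sdist bsrc btgt (siteScale S hS hdivS lvl zc hcover) (ctrU N (S (lvl k)) (zc k))
        (ctrU N (S (lvl k')) (zc k')))
      (sandwich (cmat (levelOp bsrc btgt c Rm (fun l x => ctrU N (S l) (tblk (hS l) (hdivS l) x))
        (fun l x => ω l (ctrU N (S l) (tblk (hS l) (hdivS l) x))) T a)) q)
      (Nq / ((C - 2 * d * cmax ^ 2 * κ ^ 2 - amax * (Real.exp (2 * d * κ) - 1)) * ((Smax : ℝ) ^ 2)⁻¹) *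
        Real.exp (2 * κ * (2 * d)) *
        ((3 * ((L : ℝ) ^ (1 : ℕ)) ^ 2) ^ d * ((d.factorial : ℝ) / ε ^ d) * Real.exp (2 * d * (ε + Real.log L / R' * d)) *
            Real.exp (ε + 2 * (Real.log L / R') * d) /
          (1 - Real.exp (ε + 2 * (Real.log L / R') * d) * Real.exp (-(κ - κ'))))) :=
  wrs_cellSandwich_levelOp_of_grading S hS hdivS lvl zc hdisj hcover Rm hRm T hT a ha ω hsupp hamax hscale c hc hcoer hκ0 hκ1 hμ
    hSmax1 hSmax q hq hNq0 hNq hL e hne hR (abs_level_sub_le e _ hL hne hR hsep) hε hκ' hrate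

/-- **WEIGHTED ROW SUMS OF `(levelOp)⁻¹` OVER THE (2.1)–(2.2) SHAPE.**  `MultiscaleGrowthCells.wrs_inv_levelOp_le_of_grading` with its
additive datum SUPPLIED by `abs_level_sub_le` (`A = 1`): DATA = partition with levels + (SEP) + `ε` + the rate condition
`0 ≤ κ − κ′ − log L∕R′`, `e^{ε + d·log L∕R′}·e^{−(κ−κ′−log L∕R′)} < 1`.
[cite: Balaban1988RG2Cluster, (2.16) p.15; Balaban1985BackgroundPropagators, (3.41)-(3.42) p.397; Balaban1984PropagatorsII, (2.1)-(2.2) p.224]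
[folklore] -/
theorem wrs_inv_levelOp_le_of_nesting
    (hdisj : ∀ k k' v v', cellPt S hS hdivS lvl zc k v = cellPt S hS hdivS lvl zc k' v' → k = k')
    (hcover : ∀ x : UT N, ∃ k, ∃ v : Box d (S (lvl k)), cellPt S hS hdivS lvl zc k v = x)
    (Rm : UT N × Fin d → Cp → Cp → ℝ) (hRm : ∀ b i j, ∑ k, Rm b k i * Rm b k j = if i = j then (1 : ℝ) else 0)
    (T : J → UT N → Cp → Cp → ℝ) (hT : ∀ l x i i', ∑ k, T l x k i * T l x k i' = if i = i' then (1 : ℝ) else 0)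
    (a : J → ℝ) (ha : ∀ j, 0 ≤ a j) (ω : J → UT N → ℝ)
    (hsupp : ∀ l x, ω l (ctrU N (S l) (tblk (hS l) (hdivS l) x)) ≠ 0 → ∃ k v, lvl k = l ∧ cellPt S hS hdivS lvl zc k v = x)
    {amax : ℝ} (hamax : 0 ≤ amax)
    (hscale : ∀ k, a (lvl k) * ω (lvl k) (ctrU N (S (lvl k)) (zc k)) ^ 2 * (S (lvl k) : ℝ) ^ d ≤ amax / (S (lvl k) : ℝ) ^ 2)
    (c : UT N × Fin d → ℝ) {cmax : ℝ} (hc : ∀ b, |c b| ≤ cmax) {C : ℝ}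
    (hcoer : ∀ f : UT N × Cp → ℝ,
      C * ∑ k, ((S (lvl k) : ℝ) ^ 2)⁻¹ * ∑ v : Box d (S (lvl k)), ∑ i, f (cellPt S hS hdivS lvl zc k v, i) ^ 2 ≤
        ∑ p, f p * levelOp bsrc btgt c Rm (fun l x => ctrU N (S l) (tblk (hS l) (hdivS l) x))
          (fun l x => ω l (ctrU N (S l) (tblk (hS l) (hdivS l) x))) T a f p)
    {κ : ℝ} (hκ0 : 0 ≤ κ) (hκ1 : κ ≤ 1) (hμ : 0 < C - 2 * d * cmax ^ 2 * κ ^ 2 - amax * (Real.exp (2 * d * κ) - 1))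
    {L : ℕ} (hL : 1 ≤ L) (e : UT N → ℕ) (hne : ∀ x, siteScale S hS hdivS lvl zc hcover x = L ^ e x) {R' : ℝ} (hR : 0 < R')
    (hsep : ∀ (j : ℕ) (x y : UT N), e x + 1 ≤ j → j + 1 ≤ e y → R' * (L : ℝ) ^ j + 1 ≤ dist x y)
    {ε : ℝ} (hε : 0 < ε) {κ' : ℝ} (hδ : 0 ≤ κ - κ' - Real.log L / R')
    (hrate : Real.exp (ε + Real.log L / R' * d) * Real.exp (-(κ - κ' - Real.log L / R')) < 1) (p : UT N × Cp) :
    ∑ q, |Ring.inverse (levelOp bsrc btgt c Rm (fun l x => ctrU N (S l) (tblk (hS l) (hdivS l) x))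
          (fun l x => ω l (ctrU N (S l) (tblk (hS l) (hdivS l) x))) T a) (Pi.single q 1) p| *
        Real.exp (κ' * sdist bsrc btgt (siteScale S hS hdivS lvl zc hcover) p.1 q.1) ≤
      (C - 2 * d * cmax ^ 2 * κ ^ 2 - amax * (Real.exp (2 * d * κ) - 1))⁻¹ * (L : ℝ) ^ (1 : ℕ) * (Fintype.card Cp) *
        ((3 * (L : ℝ) ^ (1 : ℕ)) ^ d * ((d.factorial : ℝ) / ε ^ d) * Real.exp (ε + Real.log L / R' * d) /
          (1 - Real.exp (ε + Real.log L / R' * d) * Real.exp (-(κ - κ' - Real.log L / R')))) *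
        (siteScale S hS hdivS lvl zc hcover p.1 : ℝ) ^ (d + 2) :=
  wrs_inv_levelOp_le_of_grading S hS hdivS lvl zc hdisj hcover Rm hRm T hT a ha ω hsupp hamax hscale c hc hcoer hκ0 hκ1 hμ hL e hne hR
    (abs_level_sub_le e _ hL hne hR hsep) hε hδ hrate p

end Ends

end
end Summit.QuantumFields.BalabanUV.Beta.MultiscaleNestedGrading
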